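import Summits.BirchSwinnertonDyer.BirchSwinnertonDyer.Theorems.SignedLowerHalvesSprungLowerDivisibilityAtThreeKatoSporadicLedgerJoint
import Mathlib.Algebra.Module.Torsion.Basic
import HarnessLib

/-!
# Crux `SprungLowerDivisibilityAtThree` (item stmt-BirchSwinnertonDyer-19875), line `chromatic-common-zeros`, skeleton v8:
# the COKERNEL SKELETON behind the displayed hypothesis F-α of the ledger doors — pure module algebra:
# `ℓ_𝔭 tors(R²/R·(a,b)) = min(ℓ_𝔭 R/(a), ℓ_𝔭 R/(b))` (card k6 H-A1) and «joint Coleman injective with cokernel of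
# length `0` at `𝔭` ∧ `𝐇¹` cyclic ∧ Poitou–Tate exact at `H¹_Iw(ℚ_p,T)` ⟹ `j(𝔭) ≤ ℓ_𝔭 tors X_{p^∞}`»

Cell `bsd-ssimc` (host), width seat `cruxlead-stmt-BirchSwinnertonDyer-19875-w3` (gen 6) under the 19875 LEAD; `--supports`
stmt-BirchSwinnertonDyer-19875 `--as helper`; theorems only (no `def`, no named fact, no instance); closes NO item. HONEST
FRAMING: this is the ALGEBRA that a future discharge of the cokernel bound F-α (the LEAD g4's planned child-22569 stub
`stub_sporadicCokerBound`; hypothesis `hFα` of `stub_katoFineLowerSporadic_of_ledgerDoor` p648498, `stubs_offT_of_ledgerDoor`)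
must run once its three printed inputs are TYPED on the tree's objects; nothing arithmetic is asserted here, no object of the
package is constructed; K_spor, S4b-cyc, K1, leaf X8 and BSD are NOT proved by anything here.

THE SKELETON (STUB-PLAN §3 α3, card k6's `localPackage` route, in abstract modules over a UFD `R`, e.g. `Λ = ℤ_p⟦T⟧`):
* `H` = Kato's `𝐇¹` — CYCLIC, `H = R·h₀` (Kato 2004 Thm. 12.4 (3): free of rank one when `E[p]` is irreducible — automatic on X8);
* `P` = the local Iwasawa cohomology `H¹_Iw(ℚ_p, T)` (tree: the functional model `localTowerPointsOfEmb →+ ℤ_p` with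
  `Sprung2012.lambdaSMul`), `loc : H → P`;
* `J = (Col♯, Col♭) : P → R × R` the JOINT Coleman map, INJECTIVE with `ℓ_𝔭(R²/range J) = 0` at the height-one prime `𝔭`
  — in print the cokernel is `ℤ_p = Λ/(T)` (Kurihara–Pollack 2007 Prop. 1.2 for `a_p = 0`; Sprung 2012 §7.1 Props. 7.3/7.6
  (individual surjectivity); Lei–Sujatha 2021 (SES-KP) «as given by [KP] and [Sprung]»), so the hypothesis holds at EVERY
  `𝔭 ≠ (T)`; the package fields are `Cs.colMap = Col♯ ∘ loc`, `Cf.colMap = Col♭ ∘ loc` (`hcs`, `hcf`);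
* `toX : P → X` with `Function.Exact loc toX` — the Poitou–Tate sequence `𝐇¹ → H¹_Iw(ℚ_p,T) → X_{p^∞}(E/ℚ_∞) → X₀ → 0`
  (Kato (17.13.1) p. 279–280; Kobayashi 2003 Thm. 7.3; exactness at `H¹_Iw` is all that is used);
* (displayed where used) `ℓ_𝔭(tors X) ≤ ℓ_𝔭 Y` — Wingberg 1989 Cor. 2.5 / Matar 2020 Thm. 1.1 `char tors X_{p^∞} = char(X₀)^ι`,
  read for the `γ`-keyed fine datum `Y = X₀ ∘ ι` at the SAME prime (STUB-PLAN §0bis; x8 lit T63 (c): print-exact), with weak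
  Leopoldt for `E/ℚ_∞` as its printed hypothesis.
THEN (§2) `min(ℓ_𝔭 R/range Col♯∘loc, ℓ_𝔭 R/range Col♭∘loc) ≤ ℓ_𝔭(tors X) ≤ ℓ_𝔭 Y` — the cokernel bound F-α at `𝔭` in the
package currency of the ledger doors. The Tate-line side condition of print enters only through where the PT exactness / the
cokernel hypothesis are available, i.e. through the typed facts, not through this algebra.

* §1 (pure algebra, any commutative ring / domain / UFD as marked): `lengthAt_eq_of_le_of_smul_le` (submodules agreeing after
  localisation), `map_torsion_le`, `map_torsion_eq_of_linearEquiv`, `lengthAt_torsion_eq_of_linearEquiv`,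
  `lengthAt_torsion_le_add_of_injective` (`ψ : Q ↪ M` ⟹ `ℓ_𝔭 tors M ≤ ℓ_𝔭 tors Q + ℓ_𝔭(M/range ψ)`),
  `lengthAt_torsion_le_of_injective`, and **`lengthAt_torsion_quotient_span_pair_eq_min`** (`ℓ_𝔭 tors(R²/R·(a,b)) = min`; via
  `…_of_le`: the torsion agrees at `𝔭 = (π)` with `R·[(a', π^{β−α}b')] ≅ R/(π^α)`).
* §2 **`min_lengthAt_quotient_range_le_lengthAt_torsion_of_skeleton`** and `…_of_torsion_le` (+ Wingberg/Matar displayed).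

References: [Kato2004Asterisque] Thm. 12.4 (3) (p. 221), §17.13 with (17.13.1) (pp. 279–280); [Sprung2012] §7.1 Def. 7.1, Props.
7.3/7.6 (pp. 1500–1501), Thm. 7.14 (3) (p. 1504); [KuriharaPollack2007] Prop. 1.2, §3 Props. 3.3–3.4; [LeiSujatha2021] (SES-KP), (PT),
Prop. 3.1; [Kobayashi2003] Thm. 7.3; [Wingberg1989] Cor. 2.5; [Matar2020] Thm. 1.1; [Washington1997] §13.2; [BourbakiAC5to7] VII §4.4;
tree: `…KatoSporadicLedgerJoint` (p648952: `lengthAt_quotient_span_pair_eq_min`, the ideal twin), `…KatoSporadicLedgerDoor` (p648498),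
`…OffTLedgerDoor`, `IwasawaAlgebraDivisibilityProofs` (`lengthAt_quotient_span_singleton_pow_mul`), Mathlib `Submodule.torsion`.
-/

set_option linter.dupNamespace false
set_option autoImplicit false

noncomputable section

open scoped Classical

open Literature.NumberTheory.EllipticCurves Literature.NumberTheory.EllipticCurves.Module
  Summit.BirchSwinnertonDyer.BirchSwinnertonDyer.Theorems.SmallImageSignedMuDefect

namespace Summit.BirchSwinnertonDyer.BirchSwinnertonDyer.Theorems.ChromaticCommonZeros

/-! ### §1 Pure algebra: torsion of `R²/R·(a, b)` at a height-one prime -/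

section TorsionPair

variable {R : Type*} [CommRing R]
variable {M : Type*} [AddCommGroup M] [Module R M]

/-- **Submodules that agree after localisation have the same local length**: `A ≤ B`, `s • B ⊆ A`, `s ∉ 𝔭` ⟹
`ℓ_𝔭 A = ℓ_𝔭 B` (`B/A` is `s`-torsion). [folklore] -/
theorem lengthAt_eq_of_le_of_smul_le (A B : Submodule R M) (hAB : A ≤ B) {s : R} (𝔭 : PrimeSpectrum R)
    (hs : s ∉ 𝔭.asIdeal) (hsB : ∀ x ∈ B, s • x ∈ A) :
    Module.lengthAt R A 𝔭 = Module.lengthAt R B 𝔭 := by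
  -- `A` as a submodule of `B`
  set A' : Submodule R B := A.comap B.subtype with hA'
  have hA : Module.lengthAt R A' 𝔭 = Module.lengthAt R A 𝔭 :=
    lengthAt_eq_of_linearEquiv (Submodule.comapSubtypeEquivOfLe hAB) 𝔭
  have htors : Module.IsTorsionBy R (B ⧸ A') s := by
    intro q
    obtain ⟨x, rfl⟩ := Submodule.Quotient.mk_surjective A' q
    rw [← Submodule.Quotient.mk_smul, Submodule.Quotient.mk_eq_zero, hA', Submodule.mem_comap]
    exact hsB x x.2
  rw [lengthAt_eq_add_quotient A' 𝔭, hA, lengthAt_eq_zero_of_isTorsionBy htors 𝔭 hs, add_zero]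

/-- Linear maps send torsion into torsion. [folklore] -/
theorem map_torsion_le {N : Type*} [AddCommGroup N] [Module R N] (f : M →ₗ[R] N) :
    (Submodule.torsion R M).map f ≤ Submodule.torsion R N := by
  rintro _ ⟨x, hx, rfl⟩
  obtain ⟨a, ha⟩ := (Submodule.mem_torsion_iff x).mp hx
  exact (Submodule.mem_torsion_iff _).mpr ⟨a, by rw [Submonoid.smul_def, ← map_smul, ← Submonoid.smul_def, ha, map_zero]⟩

variable [IsDomain R]

/-- **The torsion of `R²/R·(π^α a', π^β b')` at `𝔭 = (π)` has length `α` when `α ≤ β`, `π ∤ a'`** (`a' ≠ 0`): it agrees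
after localisation at `𝔭` with the cyclic submodule generated by the class of `w = (a', π^{β−α} b')`, which is
`≅ R/(π^α)`. [folklore] [cite: Washington1997, §13.2] -/
theorem lengthAt_torsion_quotient_span_pair_of_le {π : R} (hπ : Prime π) (𝔭 : PrimeSpectrum R)
    (h𝔭 : 𝔭.asIdeal = Ideal.span {π}) {α β : ℕ} (hαβ : α ≤ β) {a' : R} (b' : R) (ha' : ¬ π ∣ a') :
    Module.lengthAt R (Submodule.torsion R ((R × R) ⧸ Submodule.span R {((π ^ α * a', π ^ β * b') : R × R)})) 𝔭 =
      α := by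
  have ha'0 : a' ≠ 0 := fun h => ha' (h ▸ dvd_zero π)
  set v₀ : R × R := (π ^ α * a', π ^ β * b') with hv₀
  set N : Submodule R (R × R) := Submodule.span R {v₀} with hN
  set w : R × R := (a', π ^ (β - α) * b') with hw
  have hvw : v₀ = (π ^ α) • w := by
    rw [hw, Prod.smul_mk, smul_eq_mul, smul_eq_mul, ← mul_assoc, ← pow_add, Nat.add_sub_cancel' hαβ]
  have hw0 : w ≠ 0 := fun h => ha'0 (congrArg Prod.fst h)
  -- the cyclic submodule `A = R·[w]` of the torsion
  set A : Submodule R ((R × R) ⧸ N) := Submodule.span R {N.mkQ w} with hA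
  have hAle : A ≤ Submodule.torsion R ((R × R) ⧸ N) := by
    rw [hA, Submodule.span_singleton_le_iff_mem, Submodule.mem_torsion_iff]
    refine ⟨⟨π ^ α, mem_nonZeroDivisors_of_ne_zero (pow_ne_zero α hπ.ne_zero)⟩, ?_⟩
    rw [Submonoid.smul_def, ← map_smul, ← hvw, Submodule.mkQ_apply, Submodule.Quotient.mk_eq_zero, hN]
    exact Submodule.mem_span_singleton_self v₀
  -- `a' • (torsion) ⊆ A`
  have hsB : ∀ t ∈ Submodule.torsion R ((R × R) ⧸ N), a' • t ∈ A := by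
    intro t ht
    obtain ⟨⟨x, y⟩, rfl⟩ := Submodule.Quotient.mk_surjective N t
    obtain ⟨⟨r, hr⟩, hrt⟩ := (Submodule.mem_torsion_iff _).mp ht
    have hr0 : r ≠ 0 := nonZeroDivisors.ne_zero hr
    rw [Submonoid.smul_def, ← Submodule.mkQ_apply, ← map_smul, Submodule.mkQ_apply,
      Submodule.Quotient.mk_eq_zero, hN, Submodule.mem_span_singleton] at hrt
    obtain ⟨s, hs⟩ := hrt
    -- `r x = s π^α a'`, `r y = s π^β b'`
    rw [hv₀, Prod.smul_mk, Prod.smul_mk, smul_eq_mul, smul_eq_mul, Prod.mk.injEq] at hs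
    obtain ⟨hsx, hsy⟩ := hs
    change s * (π ^ α * a') = r * x at hsx
    change s * (π ^ β * b') = r * y at hsy
    -- hence `a' y = x π^{β-α} b'`
    have hβ : π ^ β = π ^ α * π ^ (β - α) := by rw [← pow_add, Nat.add_sub_cancel' hαβ]
    have key : a' * y = x * (π ^ (β - α) * b') := by
      have h1 : r * (a' * y) = r * (x * (π ^ (β - α) * b')) := by
        calc r * (a' * y) = a' * (r * y) := by ring
          _ = a' * (s * (π ^ β * b')) := by rw [hsy]
          _ = (s * (π ^ α * a')) * (π ^ (β - α) * b') := by rw [hβ]; ring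
          _ = r * x * (π ^ (β - α) * b') := by rw [hsx]
          _ = r * (x * (π ^ (β - α) * b')) := by ring
      exact mul_left_cancel₀ hr0 h1
    have hxy : a' • ((x, y) : R × R) = x • w := by
      rw [hw, Prod.smul_mk, Prod.smul_mk, smul_eq_mul, smul_eq_mul, smul_eq_mul, smul_eq_mul, mul_comm a' x, key]
    rw [← Submodule.mkQ_apply, ← map_smul, hxy, map_smul, hA]
    exact Submodule.smul_mem _ x (Submodule.mem_span_singleton_self _)
  have hs𝔭 : a' ∉ 𝔭.asIdeal := by rwa [h𝔭, Ideal.mem_span_singleton]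
  rw [← lengthAt_eq_of_le_of_smul_le A _ hAle 𝔭 hs𝔭 hsB]
  -- `A ≅ R/(π^α)`
  set φ : R →ₗ[R] (R × R) ⧸ N := LinearMap.toSpanSingleton R _ (N.mkQ w) with hφ
  have hrange : LinearMap.range φ = A := by rw [hφ, LinearMap.range_toSpanSingleton, hA]
  have hker : LinearMap.ker φ = Ideal.span {π ^ α} := by
    ext r
    rw [LinearMap.mem_ker, hφ, LinearMap.toSpanSingleton_apply, Submodule.mkQ_apply, ← Submodule.Quotient.mk_smul,
      Submodule.Quotient.mk_eq_zero, hN, Submodule.mem_span_singleton, Ideal.mem_span_singleton]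
    constructor
    · rintro ⟨s, hs⟩
      rw [hvw, smul_smul] at hs
      have hs' : (s * π ^ α - r) • w = 0 := by rw [sub_smul, hs, sub_self]
      have hsr : s * π ^ α - r = 0 := by
        by_contra hne
        exact hw0 (smul_eq_zero.mp hs' |>.resolve_left hne)
      exact ⟨s, by linear_combination -hsr⟩
    · rintro ⟨c, rfl⟩
      exact ⟨c, by rw [hvw, smul_smul, mul_comm]⟩
  rw [← hrange, ← lengthAt_eq_of_linearEquiv φ.quotKerEquivRange 𝔭, hker]
  have hone : ¬ π ∣ (1 : R) := fun h => hπ.not_unit (isUnit_of_dvd_one h)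
  have h1 := lengthAt_quotient_span_singleton_pow_mul hπ α hone 𝔭 h𝔭
  rwa [mul_one] at h1

/-- Linear equivalences identify torsion submodules. [folklore] -/
theorem map_torsion_eq_of_linearEquiv {N : Type*} [AddCommGroup N] [Module R N] (e : M ≃ₗ[R] N) :
    (Submodule.torsion R M).map (e : M →ₗ[R] N) = Submodule.torsion R N := by
  refine le_antisymm (map_torsion_le (e : M →ₗ[R] N)) ?_
  intro y hy
  refine ⟨e.symm y, ?_, by simp⟩
  have := map_torsion_le (e.symm : N →ₗ[R] M) ⟨y, hy, rfl⟩
  simpa using this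

/-- `ℓ_𝔭(tors M) = ℓ_𝔭(tors N)` for `M ≃ₗ N`. [folklore] -/
theorem lengthAt_torsion_eq_of_linearEquiv {N : Type*} [AddCommGroup N] [Module R N] (e : M ≃ₗ[R] N)
    (𝔭 : PrimeSpectrum R) :
    Module.lengthAt R (Submodule.torsion R M) 𝔭 = Module.lengthAt R (Submodule.torsion R N) 𝔭 := by
  have h := lengthAt_eq_of_linearEquiv
    (Submodule.equivMapOfInjective (e : M →ₗ[R] N) e.injective (Submodule.torsion R M)) 𝔭
  rw [h, map_torsion_eq_of_linearEquiv e]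

omit [IsDomain R] in
/-- **Torsion under an injection with short cokernel:** for `ψ : Q ↪ M` injective,
`ℓ_𝔭(tors M) ≤ ℓ_𝔭(tors Q) + ℓ_𝔭(M ⧸ range ψ)` (`tors M ∩ range ψ = ψ(tors Q)` and `tors M/(tors M ∩ range ψ) ↪ M/range ψ`).
[folklore] -/
theorem lengthAt_torsion_le_add_of_injective {Q : Type*} [AddCommGroup Q] [Module R Q] (ψ : Q →ₗ[R] M)
    (hψ : Function.Injective ψ) (𝔭 : PrimeSpectrum R) :
    Module.lengthAt R (Submodule.torsion R M) 𝔭 ≤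
      Module.lengthAt R (Submodule.torsion R Q) 𝔭 + Module.lengthAt R (M ⧸ LinearMap.range ψ) 𝔭 := by
  set TM := Submodule.torsion R M with hTM
  set B' : Submodule R TM := (LinearMap.range ψ).comap TM.subtype with hB'
  rw [lengthAt_eq_add_quotient B' 𝔭]
  gcongr
  · -- `B' = tors M ∩ range ψ` is the image of `comap ψ (tors M) ≤ tors Q` under `ψ`
    set C : Submodule R Q := TM.comap ψ with hC
    have hCle : C ≤ Submodule.torsion R Q := by
      intro q hq
      rw [hC, Submodule.mem_comap, hTM, Submodule.mem_torsion_iff] at hq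
      obtain ⟨a, ha⟩ := hq
      refine (Submodule.mem_torsion_iff q).mpr ⟨a, hψ ?_⟩
      rw [Submonoid.smul_def, map_smul, map_zero, ← Submonoid.smul_def, ha]
    -- the map `C → B'`, `q ↦ ψ q`
    have hmap : ∀ q : C, ψ (q : Q) ∈ TM := fun q => q.2
    let g : C →ₗ[R] B' :=
      { toFun := fun q => ⟨⟨ψ (q : Q), hmap q⟩, by
          rw [hB', Submodule.mem_comap, Submodule.subtype_apply]
          exact LinearMap.mem_range_self ψ (q : Q)⟩
        map_add' := fun q q' => by ext; simp
        map_smul' := fun r q => by ext; simp }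
    have hg : Function.Surjective g := by
      rintro ⟨⟨m, hm⟩, hmB⟩
      rw [hB', Submodule.mem_comap, Submodule.subtype_apply] at hmB
      obtain ⟨q, rfl⟩ := hmB
      exact ⟨⟨q, by rw [hC, Submodule.mem_comap]; exact hm⟩, rfl⟩
    exact (lengthAt_le_of_surjective g hg 𝔭).trans
      (lengthAt_le_of_injective (Submodule.inclusion hCle) (Submodule.inclusion_injective hCle) 𝔭)
  · -- `tors M / B' ↪ M / range ψ`
    have hle : B' ≤ (LinearMap.range ψ).comap TM.subtype := le_rfl
    refine lengthAt_le_of_injective (Submodule.mapQ B' (LinearMap.range ψ) TM.subtype hle) ?_ 𝔭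
    rw [← LinearMap.ker_eq_bot, Submodule.ker_mapQ, ← hB', Submodule.mkQ_map_self]

omit [IsDomain R] in
/-- **Torsion is monotone under injections:** `ℓ_𝔭(tors Q) ≤ ℓ_𝔭(tors X)` for `g : Q ↪ X`. [folklore] -/
theorem lengthAt_torsion_le_of_injective {Q X : Type*} [AddCommGroup Q] [Module R Q] [AddCommGroup X]
    [Module R X] (g : Q →ₗ[R] X) (hg : Function.Injective g) (𝔭 : PrimeSpectrum R) :
    Module.lengthAt R (Submodule.torsion R Q) 𝔭 ≤ Module.lengthAt R (Submodule.torsion R X) 𝔭 := by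
  have h : ∀ q ∈ Submodule.torsion R Q, g q ∈ Submodule.torsion R X :=
    fun q hq => map_torsion_le g ⟨q, hq, rfl⟩
  refine lengthAt_le_of_injective (g.restrict h) ?_ 𝔭
  intro q q' hqq'
  apply Subtype.ext
  apply hg
  simpa [LinearMap.restrict_apply] using congrArg Subtype.val hqq'

variable [UniqueFactorizationMonoid R]

/-- **`ℓ_𝔭 tors(R²/R·(a, b)) = min(ℓ_𝔭 R/(a), ℓ_𝔭 R/(b))` at a height-one prime of a UFD** (`a, b ≠ 0`; card k6 H-A1, the
`Λ²`-torsion twin of `lengthAt_quotient_span_pair_eq_min`): the cokernel `Λ²/Λ·(Col♯ c₀, Col♭ c₀)` of a rank-one lattice in the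
rank-two local Iwasawa cohomology has torsion of local length `min(c♯, c♭)` = the LOCAL INDEX `j`. [folklore] [cite: Washington1997, §13.2] -/
theorem lengthAt_torsion_quotient_span_pair_eq_min (a b : R) (ha : a ≠ 0) (hb : b ≠ 0)
    (𝔭 : PrimeSpectrum R) (h𝔭 : 𝔭.asIdeal.height = 1) :
    Module.lengthAt R (Submodule.torsion R ((R × R) ⧸ Submodule.span R {((a, b) : R × R)})) 𝔭 =
      min (Module.lengthAt R (R ⧸ Ideal.span {a}) 𝔭) (Module.lengthAt R (R ⧸ Ideal.span {b}) 𝔭) := by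
  have hne : 𝔭.asIdeal ≠ ⊥ := Ideal.ne_bot_of_height_eq_one h𝔭
  obtain ⟨π, hπmem, hπ⟩ := 𝔭.isPrime.exists_mem_prime_of_ne_bot hne
  have h𝔭π : 𝔭.asIdeal = Ideal.span {π} := Ideal.eq_span_singleton_of_height_eq_one h𝔭 hπmem hπ
  obtain ⟨α, a', ha', rfl⟩ := WfDvdMonoid.max_power_factor ha hπ.irreducible
  obtain ⟨β, b', hb', rfl⟩ := WfDvdMonoid.max_power_factor hb hπ.irreducible
  rw [lengthAt_quotient_span_singleton_pow_mul hπ α ha' 𝔭 h𝔭π,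
    lengthAt_quotient_span_singleton_pow_mul hπ β hb' 𝔭 h𝔭π]
  rcases le_total α β with hαβ | hβα
  · rw [lengthAt_torsion_quotient_span_pair_of_le hπ 𝔭 h𝔭π hαβ b' ha', min_eq_left (Nat.cast_le.mpr hαβ)]
  · -- swap the two coordinates
    set N : Submodule R (R × R) := Submodule.span R {((π ^ α * a', π ^ β * b') : R × R)} with hN
    set N' : Submodule R (R × R) := Submodule.span R {((π ^ β * b', π ^ α * a') : R × R)} with hN'
    have hmap : N.map (LinearEquiv.prodComm R R R : R × R →ₗ[R] R × R) = N' := by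
      rw [hN, Submodule.map_span, Set.image_singleton]
      rfl
    have e : ((R × R) ⧸ N) ≃ₗ[R] ((R × R) ⧸ N') := Submodule.Quotient.equiv N N' (LinearEquiv.prodComm R R R) hmap
    rw [lengthAt_torsion_eq_of_linearEquiv e 𝔭, hN',
      lengthAt_torsion_quotient_span_pair_of_le hπ 𝔭 h𝔭π hβα a' hb', min_eq_right (Nat.cast_le.mpr hβα)]

end TorsionPair

/-! ### §2 The cokernel skeleton: `j(𝔭) ≤ ℓ_𝔭(tors X)` from joint Coleman + Poitou–Tate, over abstract modules -/

section Skeleton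

variable {R : Type*} [CommRing R] [IsDomain R] [UniqueFactorizationMonoid R]
  {H P X : Type*} [AddCommGroup H] [Module R H] [AddCommGroup P] [Module R P] [AddCommGroup X] [Module R X]

omit [IsDomain R] [UniqueFactorizationMonoid R] in
/-- The range of a linear functional on a cyclic `H = R·h₀` is the principal ideal `(c h₀)` (plumbing). [folklore] -/
theorem range_eq_span_of_cyclic (c : H →ₗ[R] R) (h₀ : H) (hcyc : ∀ h : H, ∃ r : R, r • h₀ = h) :
    LinearMap.range c = Ideal.span {c h₀} := by
  ext y
  rw [LinearMap.mem_range, Ideal.mem_span_singleton']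
  constructor
  · rintro ⟨h, rfl⟩
    obtain ⟨r, rfl⟩ := hcyc h
    exact ⟨r, by rw [map_smul, smul_eq_mul]⟩
  · rintro ⟨r, rfl⟩
    exact ⟨r • h₀, by rw [map_smul, smul_eq_mul]⟩

/-- **THE COKERNEL SKELETON (abstract form of STUB-PLAN §3 α3 / card k6 `localPackage`).** Data: `R`-modules `H` (Kato's
`𝐇¹`, CYCLIC: `H = R·h₀` — Kato Thm. 12.4 (3) under `E[p]` irreducible), `P` (the local Iwasawa cohomology `H¹_Iw(ℚ_p, T)`),
`X` (the `p^∞`-Selmer dual over `ℚ_∞`); `loc : H → P` and `toX : P → X` EXACT at `P` (Poitou–Tate, Kato (17.13.1):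
`𝐇¹ → H¹_Iw(ℚ_p,T) → X_{p^∞} → X₀ → 0`); the JOINT Coleman map `J = (Col♯, Col♭) : P → R²`, injective, whose cokernel has
`ℓ_𝔭 = 0` at the height-one prime `𝔭` (Kurihara–Pollack / Sprung §7.1 / Lei–Sujatha (SES-KP): cokernel `= Λ/(T)`, so every
`𝔭 ≠ (T)`); the two colour maps `cs = Col♯ ∘ loc`, `cf = Col♭ ∘ loc` on `H` (the package fields `C•.colMap`) with non-zero
values at `h₀`. THEN the LOCAL INDEX is fine… is bounded by the torsion of `X`:
`min(ℓ_𝔭 R/range cs, ℓ_𝔭 R/range cf) ≤ ℓ_𝔭(tors X)`.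
Proof: `range c• = (J(loc h₀))•·R`; `min = ℓ_𝔭 tors(R²/R·J(loc h₀))` (`lengthAt_torsion_quotient_span_pair_eq_min`);
`P/loc H ↪ R²/R·J(loc h₀)` via `J` with cokernel `R²/range J` of length `0`, so `ℓ tors(R²/…) ≤ ℓ tors(P/loc H)`;
`P/loc H ≅ range toX ↪ X`. With Wingberg/Matar (`ℓ_𝔭 tors X_{p^∞} = ℓ_𝔭 Y.X` for the `γ`-keyed `Y`, displayed where used)
this is the cokernel bound F-α of the ledger door. [cite: Kato2004Asterisque, Thm. 12.4 (3) (p. 221), (17.13.1) (p. 280)]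
[cite: Sprung2012, §7.1, Props. 7.3/7.6] [cite: KuriharaPollack2007, Prop. 1.2] [cite: LeiSujatha2021, (SES-KP), (PT)] -/
theorem min_lengthAt_quotient_range_le_lengthAt_torsion_of_skeleton
    (loc : H →ₗ[R] P) (toX : P →ₗ[R] X) (hexact : Function.Exact loc toX)
    (J : P →ₗ[R] R × R) (hJ : Function.Injective J)
    (cs cf : H →ₗ[R] R) (hcs : ∀ h, cs h = (J (loc h)).1) (hcf : ∀ h, cf h = (J (loc h)).2)
    (h₀ : H) (hcyc : ∀ h : H, ∃ r : R, r • h₀ = h) (hs0 : cs h₀ ≠ 0) (hf0 : cf h₀ ≠ 0)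
    (𝔭 : PrimeSpectrum R) (h𝔭 : 𝔭.asIdeal.height = 1)
    (hcoker : Module.lengthAt R ((R × R) ⧸ LinearMap.range J) 𝔭 = 0) :
    min (Module.lengthAt R (R ⧸ LinearMap.range cs) 𝔭) (Module.lengthAt R (R ⧸ LinearMap.range cf) 𝔭) ≤
      Module.lengthAt R (Submodule.torsion R X) 𝔭 := by
  -- the two colour ideals are principal, generated by the coordinates of `v₀ = J (loc h₀)`
  set v₀ : R × R := J (loc h₀) with hv₀
  have hv : v₀ = (cs h₀, cf h₀) := by rw [hv₀, hcs, hcf]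
  rw [range_eq_span_of_cyclic cs h₀ hcyc, range_eq_span_of_cyclic cf h₀ hcyc,
    ← lengthAt_torsion_quotient_span_pair_eq_min (cs h₀) (cf h₀) hs0 hf0 𝔭 h𝔭, ← hv]
  -- `N = R·v₀ = J (range loc)`
  set N : Submodule R (R × R) := Submodule.span R {v₀} with hN
  have hJrange : (LinearMap.range loc).map J = N := by
    have htop : (⊤ : Submodule R H) = Submodule.span R {h₀} := by
      refine le_antisymm (fun h _ => ?_) le_top
      obtain ⟨r, rfl⟩ := hcyc h
      exact Submodule.smul_mem _ r (Submodule.mem_span_singleton_self h₀)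
    rw [LinearMap.range_eq_map, htop, Submodule.map_span, Set.image_singleton, Submodule.map_span,
      Set.image_singleton]
  have hcomap : (N.comap J) = LinearMap.range loc := by
    rw [← hJrange, Submodule.comap_map_eq_of_injective hJ]
  have hle : LinearMap.range loc ≤ N.comap J := hcomap.ge
  -- `ψ : P / range loc ↪ R² / N` induced by `J`
  set ψ : (P ⧸ LinearMap.range loc) →ₗ[R] (R × R) ⧸ N := Submodule.mapQ _ N J hle with hψ
  have hψinj : Function.Injective ψ := by
    rw [← LinearMap.ker_eq_bot, hψ, Submodule.ker_mapQ, hcomap, Submodule.mkQ_map_self]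
  have hψrange : LinearMap.range ψ = (LinearMap.range J).map N.mkQ := by
    rw [hψ]
    unfold Submodule.mapQ
    rw [Submodule.range_liftQ, LinearMap.range_comp]
  have hNle : N ≤ LinearMap.range J := by
    rw [hN, Submodule.span_singleton_le_iff_mem, hv₀]
    exact LinearMap.mem_range_self J _
  have hcoker' : Module.lengthAt R (((R × R) ⧸ N) ⧸ LinearMap.range ψ) 𝔭 = 0 := by
    rw [hψrange, lengthAt_eq_of_linearEquiv (Submodule.quotientQuotientEquivQuotient N _ hNle) 𝔭, hcoker]
  -- `P / range loc ↪ X` (Poitou–Tate exactness)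
  have hker : LinearMap.ker toX = LinearMap.range loc := LinearMap.exact_iff.mp hexact
  set g : (P ⧸ LinearMap.range loc) →ₗ[R] X := (LinearMap.range loc).liftQ toX hker.ge with hg
  have hginj : Function.Injective g := by
    rw [← LinearMap.ker_eq_bot, hg]
    exact Submodule.ker_liftQ_eq_bot _ _ _ hker.le
  calc Module.lengthAt R (Submodule.torsion R ((R × R) ⧸ N)) 𝔭
      ≤ Module.lengthAt R (Submodule.torsion R (P ⧸ LinearMap.range loc)) 𝔭 +
          Module.lengthAt R (((R × R) ⧸ N) ⧸ LinearMap.range ψ) 𝔭 :=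
        lengthAt_torsion_le_add_of_injective ψ hψinj 𝔭
    _ = Module.lengthAt R (Submodule.torsion R (P ⧸ LinearMap.range loc)) 𝔭 := by rw [hcoker', add_zero]
    _ ≤ Module.lengthAt R (Submodule.torsion R X) 𝔭 := lengthAt_torsion_le_of_injective g hginj 𝔭

/-- **F-α from the skeleton and Wingberg/Matar (displayed).** In the situation of
`min_lengthAt_quotient_range_le_lengthAt_torsion_of_skeleton`, if moreover `ℓ_𝔭(tors X) ≤ ℓ_𝔭 Y` (Wingberg 1989 Cor. 2.5 /
Matar 2020 Thm. 1.1 `char tors X_{p^∞} = char(X₀)^ι`, read for the `γ`-keyed fine datum `Y = X₀∘ι` at the SAME prime —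
STUB-PLAN §0bis; with weak Leopoldt for `E/ℚ_∞` as its printed hypothesis), then the COKERNEL BOUND of the ledger door holds
at `𝔭`: `min(ℓ_𝔭 R/range cs, ℓ_𝔭 R/range cf) ≤ ℓ_𝔭 Y`. This is the exact shape of the hypothesis `hFα` of
`stub_katoFineLowerSporadic_of_ledgerDoor` / `stubs_offT_of_ledgerDoor` once `cs, cf := Cs.colMap, Cf.colMap`.
[cite: Wingberg1989, Cor. 2.5] [cite: Matar2020, Thm. 1.1] [cite: Kato2004Asterisque, (17.13.1) (p. 280)] -/
theorem min_lengthAt_quotient_range_le_of_skeleton_of_torsion_le {Y : Type*} [AddCommGroup Y] [Module R Y]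
    (loc : H →ₗ[R] P) (toX : P →ₗ[R] X) (hexact : Function.Exact loc toX)
    (J : P →ₗ[R] R × R) (hJ : Function.Injective J)
    (cs cf : H →ₗ[R] R) (hcs : ∀ h, cs h = (J (loc h)).1) (hcf : ∀ h, cf h = (J (loc h)).2)
    (h₀ : H) (hcyc : ∀ h : H, ∃ r : R, r • h₀ = h) (hs0 : cs h₀ ≠ 0) (hf0 : cf h₀ ≠ 0)
    (𝔭 : PrimeSpectrum R) (h𝔭 : 𝔭.asIdeal.height = 1)
    (hcoker : Module.lengthAt R ((R × R) ⧸ LinearMap.range J) 𝔭 = 0)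
    (hWin : Module.lengthAt R (Submodule.torsion R X) 𝔭 ≤ Module.lengthAt R Y 𝔭) :
    min (Module.lengthAt R (R ⧸ LinearMap.range cs) 𝔭) (Module.lengthAt R (R ⧸ LinearMap.range cf) 𝔭) ≤
      Module.lengthAt R Y 𝔭 :=
  (min_lengthAt_quotient_range_le_lengthAt_torsion_of_skeleton loc toX hexact J hJ cs cf hcs hcf h₀ hcyc hs0 hf0 𝔭 h𝔭
    hcoker).trans hWin

end Skeleton

end Summit.BirchSwinnertonDyer.BirchSwinnertonDyer.Theorems.ChromaticCommonZeros

end
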